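import Summits.FinalStateConjecture.FinalStateConjecture.Theorems.EIHFluxBalanceInertialRecessionStubChargeModelKSEnergy
import Summits.FinalStateConjecture.FinalStateConjecture.Theorems.EIHFluxBalanceInertialRecessionChartCalculus

/-!
# Route EIHFluxBalance — `InertialRecession`, line `sublinear-is-free-clean-window-charges`:
# translation covariance of the Landau–Lifshitz charges (helpers for `stub_chargeModel`, identification)

Helper file (`--supports stmt-FinalStateConjecture-10166`) for the crux
`Summit.FinalStateConjecture.FinalStateConjecture.Theses.EIHFluxBalance.InertialRecession`.

The identification evaluates the charges of spheres about MOVING centres `ξᵢ(t)`; the explicit charge of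
`…KSEnergy` is for a hole at the origin. This file transports every coordinate object of
`LandauLifshitzPseudotensor.lean` along a translation `z ↦ z − p` of `E4`
(`gram/metricDet/upper/superpotential/hField_comp_sub`) and proves the **translation covariance of the
quasi-local momenta**, `P^μ[g(· − p)](t; ξ, R) = P^μ[g](t − p⁰; ξ − p~, R)` (`quasiLocalMomentum_comp_sub`,
translation invariance of `μHE[2]`), whence the energy of every coordinate sphere about a static
Schwarzschild hole placed anywhere is its mass (`quasiLocalMomentum_schwarzschild_energy_centre`).
-/

set_option linter.dupNamespace false

noncomputable section

open MeasureTheory Set Metric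
open Literature.Geometry.Lorentzian Literature.Geometry.Lorentzian.LandauLifshitz

namespace Summit.FinalStateConjecture.FinalStateConjecture.Theorems

namespace KSCharge

variable (g : E4 → E4 →L[ℝ] E4 →L[ℝ] ℝ) (p : E4)

/-- The Gram matrix of a translated field is the translated Gram matrix. [folklore] -/
theorem gram_comp_sub (y : E4) : gram (fun z ↦ g (z - p)) y = gram g (y - p) := rfl

/-- The determinant of a translated field is the translated determinant. [folklore] -/
theorem metricDet_comp_sub (y : E4) : metricDet (fun z ↦ g (z - p)) y = metricDet g (y - p) := rfl

/-- The inverse components of a translated field are the translated ones. [folklore] -/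
theorem upper_comp_sub (y : E4) : upper (fun z ↦ g (z - p)) y = upper g (y - p) := rfl

/-- The superpotential of a translated field is the translated superpotential. [folklore] -/
theorem superpotential_comp_sub (y : E4) (μ α ν β : Fin 4) :
    superpotential (fun z ↦ g (z - p)) y μ α ν β = superpotential g (y - p) μ α ν β := rfl

/-- Coordinate partial derivatives commute with translations. [folklore] -/
theorem partialDeriv_comp_sub (μ : Fin 4) (f : E4 → ℝ) (x : E4) :
    partialDeriv μ (fun z ↦ f (z - p)) x = partialDeriv μ f (x - p) := by
  rw [partialDeriv, partialDeriv]
  have h : (fun z ↦ f (z - p)) = fun z ↦ f (z + (-p)) := by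
    funext z; rw [sub_eq_add_neg]
  rw [h, fderiv_comp_add_right, ← sub_eq_add_neg]

/-- **`h^{μνα}` of a translated field is the translated `h^{μνα}`.** [cite: LandauLifshitz1975, §96 (96.2)] -/
theorem hField_comp_sub (x : E4) (μ ν α : Fin 4) :
    hField (fun z ↦ g (z - p)) x μ ν α = hField g (x - p) μ ν α := by
  rw [hField, hField]
  congr 1
  refine Finset.sum_congr rfl fun β _ ↦ ?_
  have h : (fun y ↦ superpotential (fun z ↦ g (z - p)) y μ β ν α) =
      fun y ↦ (fun w ↦ superpotential g w μ β ν α) (y - p) :=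
    funext fun y ↦ superpotential_comp_sub g p y μ β ν α
  rw [h]
  exact partialDeriv_comp_sub p β (fun w ↦ superpotential g w μ β ν α) x

/-- Translating an event of the slice `{x⁰ = t}`: `(t, y) − p = (t − p⁰, y − p~)`. [folklore] -/
theorem ofTimeSpace_sub (t : ℝ) (y : E3) :
    E4.ofTimeSpace t y - p = E4.ofTimeSpace (t - p 0) (y - E4.spatial p) := by
  have hp : p = E4.ofTimeSpace (p 0) (E4.spatial p) := (E4.ofTimeSpace_time_spatial p).symm
  conv_lhs => rw [hp]
  ext μ
  refine Fin.cases ?_ (fun i ↦ ?_) μ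
  · simp [E4.ofTimeSpace_apply_zero]
  · simp [E4.ofTimeSpace_apply_succ]

/-- **Translation covariance of the quasi-local momenta**: the charges of the translated field
`g(· − p)` on the sphere `(t; ξ, R)` are the charges of `g` on the translated sphere
`(t − p⁰; ξ − p~, R)` (translation invariance of `μHE[2]`, `setIntegral_sphere_translate`).
[cite: LandauLifshitz1975, §96 (96.16)] -/
theorem quasiLocalMomentum_comp_sub (t : ℝ) (ξ : E3) (R : ℝ) (μ : Fin 4) :
    quasiLocalMomentum (fun z ↦ g (z - p)) t ξ R μ =
      quasiLocalMomentum g (t - p 0) (ξ - E4.spatial p) R μ := by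
  rw [quasiLocalMomentum, quasiLocalMomentum,
    SublinearIsFree.WindowCharges.setIntegral_sphere_translate _ ξ R,
    SublinearIsFree.WindowCharges.setIntegral_sphere_translate _ (ξ - E4.spatial p) R]
  refine setIntegral_congr_fun isClosed_sphere.measurableSet fun z _ ↦ ?_
  refine Finset.sum_congr rfl fun j _ ↦ ?_
  rw [hField_comp_sub, ofTimeSpace_sub]
  congr 2
  · congr 2
    abel
  · simp only [add_sub_cancel_right]

/-- **The quasi-local energy of every coordinate sphere about a static Schwarzschild hole placed at
`ξ₀` is its mass**: for the translated Kerr–Schild components `g_{M,0}(· − (t₀, ξ₀))` (equivalently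
`boostedKerrBilin 1 (t₀, ξ₀) M 0`), `P⁰(t; ξ₀, R) = M` for all `t`, `R > 0`.
[cite: LandauLifshitz1975, §96 (96.16)] -/
theorem quasiLocalMomentum_schwarzschild_energy_centre (M t₀ : ℝ) (ξ₀ : E3) (t : ℝ) {R : ℝ} (hR : 0 < R) :
    quasiLocalMomentum (fun z ↦ Kerr.bilin M 0 (z - E4.ofTimeSpace t₀ ξ₀)) t ξ₀ R 0 = M := by
  rw [quasiLocalMomentum_comp_sub, E4.spatial_ofTimeSpace, sub_self]
  exact quasiLocalMomentum_schwarzschild_energy M _ hR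

/-- The same for the crux's ansatz summand of a hole AT REST (`Λ = 1`): the lab field
`boostedKerrBilin 1 (t₀, ξ₀) M 0` has quasi-local energy `M` on every sphere about `ξ₀`.
[cite: LandauLifshitz1975, §96 (96.16)] -/
theorem quasiLocalMomentum_boostedKerrBilin_one_energy (M t₀ : ℝ) (ξ₀ : E3) (t : ℝ) {R : ℝ} (hR : 0 < R) :
    quasiLocalMomentum (boostedKerrBilin 1 (E4.ofTimeSpace t₀ ξ₀) M 0) t ξ₀ R 0 = M := by
  have h : boostedKerrBilin 1 (E4.ofTimeSpace t₀ ξ₀) M 0 =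
      fun z ↦ Kerr.bilin M 0 (z - E4.ofTimeSpace t₀ ξ₀) := funext fun z ↦ boostedKerrBilin_one _ M 0 z
  rw [h]
  exact quasiLocalMomentum_schwarzschild_energy_centre M t₀ ξ₀ t hR

end KSCharge

/-- Registered sub-goal form (stub `quasiLocalMomentum_translate` of the crux item) of
`KSCharge.quasiLocalMomentum_comp_sub`: translation covariance of the Landau–Lifshitz quasi-local momenta.
[cite: LandauLifshitz1975, §96 (96.16)] -/
theorem quasiLocalMomentum_translate : open Literature.Geometry.Lorentzian in ∀ (g : E4 → E4 →L[ℝ] E4 →L[ℝ] ℝ) (p : E4) (t : ℝ) (ξ : E3) (R : ℝ) (μ : Fin 4), LandauLifshitz.quasiLocalMomentum (fun z ↦ g (z - p)) t ξ R μ = LandauLifshitz.quasiLocalMomentum g (t - p 0) (ξ - E4.spatial p) R μ :=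
  fun g p t ξ R μ ↦ KSCharge.quasiLocalMomentum_comp_sub g p t ξ R μ

end Summit.FinalStateConjecture.FinalStateConjecture.Theorems

end
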